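import Summits.QuantumFields.BalabanUV.Beta.GAN24.DirichletRingCutoffRing
import Summits.QuantumFields.BalabanUV.Beta.GAN24.DirichletRingHessianIdentity
import Summits.QuantumFields.BalabanUV.Beta.GAN24.DirichletRingPoincare

/-!
# `BalabanUV.Beta.GAN24.DirichletRingHessianWindow` — binder row G-an2-4 / (CONV-C), road P2 PART IV, leaf L12 (model), part 1: THE HESSIAN
# WINDOW ESTIMATE `Σ_{4L<ρ<10L, x∉Q}(|∂₁²U|² + |∂₂²U|²) ≤ 2·SG_n + (84800/L²)·Ẽ_{20L+1}` AROUND A RE-ENTRANT VERTEX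
# (unit b2b-balaban-gan24-p2, gen 25, v1)

HONEST FRAMING (cell contract, verbatim): «discharging `BetaPertH` makes Bałaban's UV stability UNCONDITIONAL — a real constructive-QFT
result; it is NOT the continuum limit and NOT the Clay problem.»  The analytic step of binder (A) of memo `HOME/b2b-balaban-gan24-p2/gen24/W-FULL-WEIGHTED.md`
§2 near a re-entrant vertex, in MODEL COORDINATES, lattice units (plan `HOME/b2b-balaban-gan24-p2/gen25/RING-LEMMA-KERNEL.md` §6): `U : ℤ → ℤ → ℂ`
vanishing on the quadrant `Q`, `ΔU = G` on `Q_n ∖ Q`; the cut-off `χ_L` of `DirichletRingCutoffRing` (0 on `Q_{2L}`, 1 on `4L ≤ ρ ≤ 10L`, 0 for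
`ρ ≥ 20L`, `|δχ| ≤ 2/L`, `|δ²χ| ≤ 2/L²`) and `z = χ_L·U`:
 * §1 bookkeeping: `tIdx_step`, `sqSum_le_of_le`, **`nbr_sqSum_le`** (`Σ_{Q_K} Σ_{y∼x}‖U(y)−U(x)‖² ≤ 2Ẽ_K`), `site_sqSum_le`
   (`Σ_{Q_K}‖U‖² ≤ 3K²·E_K`, L6 `DirichletRingPoincare.local_poincare_wedge` by name);
 * §2 **`window_hessian_le`** — for `1 ≤ L`, `20L+1 ≤ n`:
   `Σ_{x ∈ Q_{20L+1}, x ∉ Q, 4L+1 ≤ ρ(x) ≤ 10L−1}(|∂₁²U(x)|² + |∂₂²U(x)|²) ≤ 2·SG_n + (84800/L²)·Ẽ_{20L+1}`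
   (`DirichletRingHessianIdentity.hessian_le_offQuadrant` for `z` on the box `Q_{20L+1}`; on the window `∂_μ²z = ∂_μ²U`; off it
   `|Δz|² ≤ 2|G|² + 2|Δz − χΔU|²` and `DirichletRingCutoff.norm_commutator_sq_le` with `α = 2/L`, `β = 2/L²`; `SG` by `sqSum_mono`).
In block units the left side at scale `L ≍ rn` is the Hessian on an annulus and the right side is `‖Δu‖² + (n/L)²·(energy at scale L)` — with
the decay `Ẽ_{20L+1} ≲ (L/n)^γ·M` (L8) the dyadic layer-cake sum gives binder (A) at the critical scale (part 2, the assembly; NOT here).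

ABSOLUTE RULE (cell, verbatim): «No internally-minted statement may enter as a cited fact. Every hypothesis is either kernel-proved in
this package or a verbatim quotation of a PUBLISHED theorem with page reference. The manuscript(s) under audit are NOT citable for
their own disputed steps — they are the thing under adjudication; programme-internal (2001/route/tribunal) claims are never citable.»
[folklore] finite lattice calculus; nothing printed is a hypothesis.  NOT CLAIMED: (A) assembled, (A)/(B) on the torus, NE2, (CONV-C), `BetaPertH`,
continuum, Clay.  «not in print; our proof attempt».  HONEST DEPENDENCY: continuum YM on T⁴ ⇐ BetaPertH ∧ nine spine estimates (0/9 proved);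
BetaPertH ⇐ (D1) ∧ (D4) ∧ CAP+tail; G-an2-4 gates asym, D1 and NE2/3/4.
-/

noncomputable section

open scoped BigOperators ComplexConjugate
open Finset

namespace Summit.QuantumFields.BalabanUV.Beta.GAN24.DirichletRingHessianWindow

open DirichletRingEnergies (hb vb EH EV En Rad Et sqSum lap En_nonneg Rad_nonneg Et_nonneg sqSum_mono sqSum_nonneg)
open DirichletRingHessianIdentity (d1 d2 boxSum offQ offQ_nonneg offQ_le_one hessian_le_offQuadrant)
open DirichletRingCutoff (tIdx eta)
open DirichletRingCutoffRing (chi chi_mem chi_eq_zero_inner chi_eq_one chi_eq_zero_outer abs_chi_sub_le₁ abs_chi_sub_le₁' abs_chi_sub_le₂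
  abs_chi_sub_le₂' abs_chi_dd_le₁ abs_chi_dd_le₂)
open DirichletRingPoincare (local_poincare_wedge)

variable (U : ℤ → ℤ → ℂ)

/-! ## §1 Bookkeeping -/

/-- the half-index moves by at most one along a lattice step. [folklore] -/
theorem tIdx_step (i : ℤ) : tIdx (i + 1) ≤ tIdx i + 1 ∧ tIdx i ≤ tIdx (i + 1) + 1 ∧ tIdx (i - 1) ≤ tIdx i + 1 ∧ tIdx i ≤ tIdx (i - 1) + 1 := by
  unfold tIdx; split_ifs <;> omega

/-- pointwise comparison of site sums. [folklore] -/
theorem sqSum_le_of_le {f g : ℤ → ℤ → ℝ} (h : ∀ i j, f i j ≤ g i j) (k : ℕ) : sqSum f k ≤ sqSum g k :=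
  sum_le_sum fun _ _ => sum_le_sum fun _ _ => h _ _

/-- the ring index `ρ = max(tIdx i, tIdx j)` (`Q_k = {ρ ≤ k}`). [folklore] -/
def rho (i j : ℤ) : ℤ := max (tIdx i) (tIdx j)

/-- the window indicator `𝟙[4L+1 ≤ ρ ≤ 10L−1]`. [folklore] -/
def win (L : ℕ) (i j : ℤ) : ℝ := if 4 * (L : ℤ) + 1 ≤ rho i j ∧ rho i j ≤ 10 * (L : ℤ) - 1 then 1 else 0

/-- the squared neighbour differences at a site. [folklore] -/
def nbr (i j : ℤ) : ℝ :=
  ‖U (i + 1) j - U i j‖ ^ 2 + ‖U (i - 1) j - U i j‖ ^ 2 + ‖U i (j + 1) - U i j‖ ^ 2 + ‖U i (j - 1) - U i j‖ ^ 2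

/-- **the neighbour differences over the square are bond energies**: `Σ_{Q_K} nbr = 2E_K + Rad_K ≤ 2Ẽ_K`. [folklore] -/
theorem nbr_sqSum_le {K : ℕ} (hK : 1 ≤ K) : sqSum (nbr U) K ≤ 2 * Et U K := by
  obtain ⟨N, hN⟩ : ∃ N, 2 * K = N + 1 := ⟨2 * K - 1, by omega⟩
  have hN' : 2 * K - 1 = N := by omega
  have eN : (-(K : ℤ) + (N : ℤ)) = (K : ℤ) - 1 := by omega
  -- forward horizontal bonds (inner index split at the last site)
  have e_fw : ∑ t ∈ range (2 * K), ∑ s ∈ range (2 * K), ‖U (-(K : ℤ) + s + 1) (-(K : ℤ) + t) - U (-(K : ℤ) + s) (-(K : ℤ) + t)‖ ^ 2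
      = ∑ t ∈ range (2 * K), ∑ s ∈ range (2 * K - 1), hb U (-(K : ℤ) + s) (-(K : ℤ) + t)
        + ∑ t ∈ range (2 * K), hb U ((K : ℤ) - 1) (-(K : ℤ) + t) := by
    rw [← sum_add_distrib]
    refine sum_congr rfl fun t _ => ?_
    rw [hN, sum_range_succ, Nat.add_sub_cancel, eN]
    simp only [hb]
  -- backward horizontal bonds (inner index split at the first site)
  have e_bw : ∑ t ∈ range (2 * K), ∑ s ∈ range (2 * K), ‖U (-(K : ℤ) + s - 1) (-(K : ℤ) + t) - U (-(K : ℤ) + s) (-(K : ℤ) + t)‖ ^ 2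
      = ∑ t ∈ range (2 * K), hb U (-(K : ℤ) - 1) (-(K : ℤ) + t)
        + ∑ t ∈ range (2 * K), ∑ s ∈ range (2 * K - 1), hb U (-(K : ℤ) + s) (-(K : ℤ) + t) := by
    rw [← sum_add_distrib]
    refine sum_congr rfl fun t _ => ?_
    rw [hN, sum_range_succ', Nat.add_sub_cancel, add_comm]
    simp only [hb, Nat.cast_zero, add_zero, Nat.cast_succ]
    congr 1
    · rw [norm_sub_rev]; ring_nf
    · refine sum_congr rfl fun s _ => ?_
      rw [norm_sub_rev]; ring_nf
  -- upward vertical bonds (outer index split at the last row)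
  have e_up : ∑ t ∈ range (2 * K), ∑ s ∈ range (2 * K), ‖U (-(K : ℤ) + s) (-(K : ℤ) + t + 1) - U (-(K : ℤ) + s) (-(K : ℤ) + t)‖ ^ 2
      = ∑ t ∈ range (2 * K - 1), ∑ s ∈ range (2 * K), vb U (-(K : ℤ) + s) (-(K : ℤ) + t)
        + ∑ s ∈ range (2 * K), vb U (-(K : ℤ) + s) ((K : ℤ) - 1) := by
    have hs := Finset.sum_range_succ (fun t => ∑ s ∈ range (N + 1), ‖U (-(K : ℤ) + s) (-(K : ℤ) + t + 1) - U (-(K : ℤ) + s) (-(K : ℤ) + t)‖ ^ 2) N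
    beta_reduce at hs
    rw [hN, Nat.add_sub_cancel, hs, eN]
    simp only [vb]
  -- downward vertical bonds (outer index split at the first row)
  have e_dn : ∑ t ∈ range (2 * K), ∑ s ∈ range (2 * K), ‖U (-(K : ℤ) + s) (-(K : ℤ) + t - 1) - U (-(K : ℤ) + s) (-(K : ℤ) + t)‖ ^ 2
      = ∑ s ∈ range (2 * K), vb U (-(K : ℤ) + s) (-(K : ℤ) - 1)
        + ∑ t ∈ range (2 * K - 1), ∑ s ∈ range (2 * K), vb U (-(K : ℤ) + s) (-(K : ℤ) + t) := by
    have hs := Finset.sum_range_succ' (fun t => ∑ s ∈ range (N + 1), ‖U (-(K : ℤ) + s) (-(K : ℤ) + t - 1) - U (-(K : ℤ) + s) (-(K : ℤ) + t)‖ ^ 2) N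
    beta_reduce at hs
    rw [hN, Nat.add_sub_cancel, hs, add_comm]
    simp only [vb, Nat.cast_zero, add_zero, Nat.cast_succ]
    congr 1
    · refine sum_congr rfl fun s _ => ?_
      rw [norm_sub_rev]; ring_nf
    · refine sum_congr rfl fun t _ => sum_congr rfl fun s _ => ?_
      rw [norm_sub_rev]; ring_nf
  -- the site sum splits into the four families
  have hsplit : sqSum (nbr U) K
      = ∑ t ∈ range (2 * K), ∑ s ∈ range (2 * K), ‖U (-(K : ℤ) + s + 1) (-(K : ℤ) + t) - U (-(K : ℤ) + s) (-(K : ℤ) + t)‖ ^ 2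
        + ∑ t ∈ range (2 * K), ∑ s ∈ range (2 * K), ‖U (-(K : ℤ) + s - 1) (-(K : ℤ) + t) - U (-(K : ℤ) + s) (-(K : ℤ) + t)‖ ^ 2
        + ∑ t ∈ range (2 * K), ∑ s ∈ range (2 * K), ‖U (-(K : ℤ) + s) (-(K : ℤ) + t + 1) - U (-(K : ℤ) + s) (-(K : ℤ) + t)‖ ^ 2
        + ∑ t ∈ range (2 * K), ∑ s ∈ range (2 * K), ‖U (-(K : ℤ) + s) (-(K : ℤ) + t - 1) - U (-(K : ℤ) + s) (-(K : ℤ) + t)‖ ^ 2 := by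
    simp only [sqSum, nbr, sum_add_distrib]
  have hEV : EV U K = ∑ t ∈ range (2 * K - 1), ∑ s ∈ range (2 * K), vb U (-(K : ℤ) + s) (-(K : ℤ) + t) := by
    rw [EV, sum_comm]
  rw [hsplit, e_fw, e_bw, e_up, e_dn, Et, En, EH, hEV, Rad]
  simp only [sum_add_distrib]
  have h0 := Rad_nonneg U K
  rw [Rad, sum_add_distrib, sum_add_distrib] at h0
  linarith

/-- **site values by the energy** (L6 by name): for `U = 0` on the quadrant and `K ≥ 1`, `Σ_{Q_K}‖U‖² ≤ 3K²·E_K`. [folklore] -/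
theorem site_sqSum_le {K : ℕ} (hK : 1 ≤ K) (hU : ∀ s t : ℤ, 0 ≤ s → 0 ≤ t → U s t = 0) :
    sqSum (fun i j => ‖U i j‖ ^ 2) K ≤ 3 * (K : ℝ) ^ 2 * En U K := by
  have h := local_poincare_wedge hK (fun s t => U (-(K : ℤ) + s) (-(K : ℤ) + t)) (fun s t h1 _ h3 _ =>
    hU _ _ (by omega) (by omega))
  rw [sum_comm] at h
  refine (le_of_eq (by rfl)).trans (h.trans (le_of_eq ?_))
  rw [En, EH, EV, sum_comm]
  simp only [hb, vb]
  push_cast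
  ring_nf

/-! ## §2 The window estimate -/

/-- **THE HESSIAN WINDOW ESTIMATE** (leaf L12, model, part 1): for `1 ≤ L`, `20L+1 ≤ n`, `U = 0` on the quadrant and `ΔU = G` on `Q_n ∖ Q`,
`Σ_{Q_{20L+1}} offQ·win_L·(|∂₁²U|² + |∂₂²U|²) ≤ 2·SG_n + (84800/L²)·Ẽ_{20L+1}`. [folklore] -/
theorem window_hessian_le {L n : ℕ} (hL : 1 ≤ L) (hLn : 20 * L + 1 ≤ n) (G : ℤ → ℤ → ℂ)
    (hU : ∀ s t : ℤ, 0 ≤ s → 0 ≤ t → U s t = 0)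
    (hEq : ∀ i j : ℤ, -(n : ℤ) ≤ i → i < n → -(n : ℤ) ≤ j → j < n → ¬(0 ≤ i ∧ 0 ≤ j) → lap U i j = G i j) :
    sqSum (fun i j => offQ i j * win L i j * (‖d1 U i j‖ ^ 2 + ‖d2 U i j‖ ^ 2)) (20 * L + 1)
      ≤ 2 * sqSum (fun i j => ‖G i j‖ ^ 2) n + 84800 / (L : ℝ) ^ 2 * Et U (20 * L + 1) := by
  set K : ℕ := 20 * L + 1 with hK
  have hK1 : 1 ≤ K := by omega
  have hL0 : (0 : ℝ) < L := by exact_mod_cast hL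
  have hLne : (L : ℝ) ≠ 0 := hL0.ne'
  -- the cut-off field
  set z : ℤ → ℤ → ℂ := fun i j => (chi L i j : ℂ) * U i j with hz
  -- support and vanishing of `z`
  have hzQ : ∀ i j : ℤ, 0 ≤ i → 0 ≤ j → z i j = 0 := fun i j hi hj => by simp only [hz, hU i j hi hj, mul_zero]
  have hzc : z (-1) 0 = 0 := by
    have h1 : tIdx (-1) = 1 := by unfold tIdx; rw [if_neg (by omega)]; ring
    have h2 : tIdx 0 = 1 := by unfold tIdx; rw [if_pos le_rfl]; ring
    simp only [hz, chi_eq_zero_inner (L := L) (i := -1) (j := 0) (by rw [h1]; omega) (by rw [h2]; omega), Complex.ofReal_zero, zero_mul]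
  have hzout : ∀ i j : ℤ, (i < -(K : ℤ) + 2 ∨ -(K : ℤ) + ((2 * K - 1 : ℕ) : ℤ) - 1 ≤ i ∨ j < -(K : ℤ) + 2 ∨ -(K : ℤ) + ((2 * K - 1 : ℕ) : ℤ) - 1 ≤ j)
      → z i j = 0 := by
    intro i j h
    have hNz : ((2 * K - 1 : ℕ) : ℤ) = 2 * (K : ℤ) - 1 := by omega
    rw [hNz] at h
    have hout : 20 * (L : ℤ) ≤ tIdx i ∨ 20 * (L : ℤ) ≤ tIdx j := by
      unfold tIdx; split_ifs <;> omega
    simp only [hz, chi_eq_zero_outer hL hout, Complex.ofReal_zero, zero_mul]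
  -- the `H²` inequality off the quadrant for `z` on the box `Q_K`
  have hH := hessian_le_offQuadrant z (-(K : ℤ)) (2 * K - 1) hzout hzQ hzc
  have e2K : 2 * K - 1 + 1 = 2 * K := by omega
  rw [e2K] at hH
  change sqSum (fun i j => offQ i j * (‖d1 z i j‖ ^ 2 + ‖d2 z i j‖ ^ 2)) K ≤ sqSum (fun i j => offQ i j * ‖lap z i j‖ ^ 2) K at hH
  -- (1) on the window the second differences of `z` are those of `U`
  have hwin : ∀ i j, offQ i j * win L i j * (‖d1 U i j‖ ^ 2 + ‖d2 U i j‖ ^ 2) ≤ offQ i j * (‖d1 z i j‖ ^ 2 + ‖d2 z i j‖ ^ 2) := by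
    intro i j
    unfold win
    split_ifs with hw
    · rw [mul_one]
      refine le_of_eq ?_
      obtain ⟨t1, t2, t3, t4⟩ := tIdx_step i
      obtain ⟨s1, s2, s3, s4⟩ := tIdx_step j
      have hρ : 4 * (L : ℤ) + 1 ≤ max (tIdx i) (tIdx j) ∧ max (tIdx i) (tIdx j) ≤ 10 * (L : ℤ) - 1 := hw
      have hmax := max_le_iff.mp hρ.2
      have hor : 4 * (L : ℤ) + 1 ≤ tIdx i ∨ 4 * (L : ℤ) + 1 ≤ tIdx j := le_max_iff.mp hρ.1
      have c0 : chi L i j = 1 := chi_eq_one hL (by omega) (by omega) (by omega)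
      have c1 : chi L (i + 1) j = 1 := chi_eq_one hL (by omega) (by omega) (by omega)
      have c2 : chi L (i - 1) j = 1 := chi_eq_one hL (by omega) (by omega) (by omega)
      have c3 : chi L i (j + 1) = 1 := chi_eq_one hL (by omega) (by omega) (by omega)
      have c4 : chi L i (j - 1) = 1 := chi_eq_one hL (by omega) (by omega) (by omega)
      simp only [hz, d1, d2, c0, c1, c2, c3, c4, Complex.ofReal_one, one_mul]
    · rw [mul_zero, zero_mul]
      exact mul_nonneg (offQ_nonneg i j) (add_nonneg (sq_nonneg _) (sq_nonneg _))
  -- (2) off the window: `|Δz|² ≤ 2|G|² + 2|Δz − χΔU|²` on the box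
  set comm : ℤ → ℤ → ℂ := fun i j => lap z i j - (chi L i j : ℂ) * lap U i j with hcomm
  have hrhs : sqSum (fun i j => offQ i j * ‖lap z i j‖ ^ 2) K
      ≤ sqSum (fun i j => 2 * ‖G i j‖ ^ 2 + 2 * ‖comm i j‖ ^ 2) K := by
    refine sum_le_sum fun t ht => sum_le_sum fun s hs => ?_
    have ht' := mem_range.mp ht
    have hs' := mem_range.mp hs
    show offQ (-(K : ℤ) + s) (-(K : ℤ) + t) * ‖lap z (-(K : ℤ) + s) (-(K : ℤ) + t)‖ ^ 2
      ≤ 2 * ‖G (-(K : ℤ) + s) (-(K : ℤ) + t)‖ ^ 2 + 2 * ‖comm (-(K : ℤ) + s) (-(K : ℤ) + t)‖ ^ 2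
    unfold offQ
    split_ifs with hq
    · rw [zero_mul]; positivity
    · rw [one_mul]
      have hG : lap U (-(K : ℤ) + s) (-(K : ℤ) + t) = G (-(K : ℤ) + s) (-(K : ℤ) + t) :=
        hEq _ _ (by omega) (by omega) (by omega) (by omega) hq
      have hdec : lap z (-(K : ℤ) + s) (-(K : ℤ) + t)
          = (chi L (-(K : ℤ) + s) (-(K : ℤ) + t) : ℂ) * G (-(K : ℤ) + s) (-(K : ℤ) + t) + comm (-(K : ℤ) + s) (-(K : ℤ) + t) := by
        simp only [hcomm, hG]; ring
      rw [hdec]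
      obtain ⟨c0, c1⟩ := chi_mem hL (-(K : ℤ) + s) (-(K : ℤ) + t)
      have hn1 : ‖(chi L (-(K : ℤ) + s) (-(K : ℤ) + t) : ℂ) * G (-(K : ℤ) + s) (-(K : ℤ) + t)‖ ≤ ‖G (-(K : ℤ) + s) (-(K : ℤ) + t)‖ := by
        rw [norm_mul, Complex.norm_real, Real.norm_eq_abs, abs_of_nonneg c0]
        exact mul_le_of_le_one_left (norm_nonneg _) c1
      have hadd := norm_add_le ((chi L (-(K : ℤ) + s) (-(K : ℤ) + t) : ℂ) * G (-(K : ℤ) + s) (-(K : ℤ) + t)) (comm (-(K : ℤ) + s) (-(K : ℤ) + t))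
      set a := (chi L (-(K : ℤ) + s) (-(K : ℤ) + t) : ℂ) * G (-(K : ℤ) + s) (-(K : ℤ) + t) with ha
      set b := comm (-(K : ℤ) + s) (-(K : ℤ) + t) with hb'
      have h0 := norm_nonneg (a + b)
      have hsq : ‖a + b‖ ^ 2 ≤ (‖a‖ + ‖b‖) ^ 2 := pow_le_pow_left₀ h0 hadd 2
      nlinarith [norm_nonneg b, norm_nonneg a, norm_nonneg (G (-(K : ℤ) + s) (-(K : ℤ) + t)), sq_nonneg (‖a‖ - ‖b‖), hn1]
  -- (3) the commutator, pointwise and summed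
  have hcpt : ∀ i j, ‖comm i j‖ ^ 2 ≤ 8 * (2 / (L : ℝ)) ^ 2 * nbr U i j + 8 * (2 / (L : ℝ) ^ 2) ^ 2 * ‖U i j‖ ^ 2 := by
    intro i j
    have h := DirichletRingCutoff.norm_commutator_sq_le (chi L) U i j (abs_chi_sub_le₁ hL i j) (abs_chi_sub_le₁' hL i j)
      (abs_chi_sub_le₂ hL i j) (abs_chi_sub_le₂' hL i j) (abs_chi_dd_le₁ hL i j) (abs_chi_dd_le₂ hL i j)
    simp only [hcomm, hz, nbr]
    exact h
  have hcsum : sqSum (fun i j => ‖comm i j‖ ^ 2) K ≤ 32 / (L : ℝ) ^ 2 * (2 * Et U K) + 32 / (L : ℝ) ^ 4 * (3 * (K : ℝ) ^ 2 * En U K) := by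
    have h1 : sqSum (fun i j => ‖comm i j‖ ^ 2) K
        ≤ sqSum (fun i j => 8 * (2 / (L : ℝ)) ^ 2 * nbr U i j + 8 * (2 / (L : ℝ) ^ 2) ^ 2 * ‖U i j‖ ^ 2) K := sqSum_le_of_le hcpt K
    have h2 : sqSum (fun i j => 8 * (2 / (L : ℝ)) ^ 2 * nbr U i j + 8 * (2 / (L : ℝ) ^ 2) ^ 2 * ‖U i j‖ ^ 2) K
        = 8 * (2 / (L : ℝ)) ^ 2 * sqSum (nbr U) K + 8 * (2 / (L : ℝ) ^ 2) ^ 2 * sqSum (fun i j => ‖U i j‖ ^ 2) K := by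
      simp only [sqSum, sum_add_distrib, mul_sum]
    rw [h2] at h1
    have e1 : 8 * (2 / (L : ℝ)) ^ 2 = 32 / (L : ℝ) ^ 2 := by ring
    have e2 : 8 * (2 / (L : ℝ) ^ 2) ^ 2 = 32 / (L : ℝ) ^ 4 := by ring
    rw [e1, e2] at h1
    refine h1.trans (add_le_add ?_ ?_)
    · exact mul_le_mul_of_nonneg_left (nbr_sqSum_le U hK1) (by positivity)
    · exact mul_le_mul_of_nonneg_left (site_sqSum_le U hK1 hU) (by positivity)
  -- (4) the `G`-sum is part of `SG_n`
  have hGsum : sqSum (fun i j => ‖G i j‖ ^ 2) K ≤ sqSum (fun i j => ‖G i j‖ ^ 2) n :=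
    sqSum_mono _ (fun _ _ => sq_nonneg _) (by omega)
  -- assemble
  have hsplit2 : sqSum (fun i j => 2 * ‖G i j‖ ^ 2 + 2 * ‖comm i j‖ ^ 2) K
      = 2 * sqSum (fun i j => ‖G i j‖ ^ 2) K + 2 * sqSum (fun i j => ‖comm i j‖ ^ 2) K := by
    simp only [sqSum, sum_add_distrib, mul_sum]
  have hEn : En U K ≤ Et U K := le_add_of_nonneg_right (Rad_nonneg U K)
  have hEt0 : 0 ≤ Et U K := Et_nonneg U K
  have hKR : (K : ℝ) ≤ 21 * L := by
    have : (K : ℝ) = 20 * L + 1 := by rw [hK]; push_cast; ring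
    rw [this]; have : (1 : ℝ) ≤ L := by exact_mod_cast hL
    linarith
  have hK0 : (0 : ℝ) ≤ K := Nat.cast_nonneg K
  calc sqSum (fun i j => offQ i j * win L i j * (‖d1 U i j‖ ^ 2 + ‖d2 U i j‖ ^ 2)) K
      ≤ sqSum (fun i j => offQ i j * (‖d1 z i j‖ ^ 2 + ‖d2 z i j‖ ^ 2)) K := sqSum_le_of_le hwin K
    _ ≤ sqSum (fun i j => offQ i j * ‖lap z i j‖ ^ 2) K := hH
    _ ≤ 2 * sqSum (fun i j => ‖G i j‖ ^ 2) K + 2 * sqSum (fun i j => ‖comm i j‖ ^ 2) K := by rw [← hsplit2]; exact hrhs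
    _ ≤ 2 * sqSum (fun i j => ‖G i j‖ ^ 2) n
        + 2 * (32 / (L : ℝ) ^ 2 * (2 * Et U K) + 32 / (L : ℝ) ^ 4 * (3 * (K : ℝ) ^ 2 * En U K)) := by
          linarith [hGsum, hcsum]
    _ ≤ 2 * sqSum (fun i j => ‖G i j‖ ^ 2) n + 84800 / (L : ℝ) ^ 2 * Et U K := by
          -- `2·(64/L² + 96K²/L⁴)·Ẽ ≤ 84800/L²·Ẽ` since `K ≤ 21L`
          have hK2 : (K : ℝ) ^ 2 ≤ 441 * (L : ℝ) ^ 2 := by nlinarith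
          have h1 : 32 / (L : ℝ) ^ 4 * (3 * (K : ℝ) ^ 2 * En U K) ≤ 32 / (L : ℝ) ^ 4 * (3 * (441 * (L : ℝ) ^ 2) * Et U K) := by
            refine mul_le_mul_of_nonneg_left ?_ (by positivity)
            exact mul_le_mul (by nlinarith) hEn (En_nonneg U K) (by positivity)
          have e : 32 / (L : ℝ) ^ 4 * (3 * (441 * (L : ℝ) ^ 2) * Et U K) = 42336 / (L : ℝ) ^ 2 * Et U K := by
            field_simp; ring
          rw [e] at h1
          have h2 : 2 * (32 / (L : ℝ) ^ 2 * (2 * Et U K) + 42336 / (L : ℝ) ^ 2 * Et U K) = 84800 / (L : ℝ) ^ 2 * Et U K := by ring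
          nlinarith [h1, h2, hEt0]

end Summit.QuantumFields.BalabanUV.Beta.GAN24.DirichletRingHessianWindow

end
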